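import Summits.NavierStokesRegularity.NavierStokesRegularity.Theorems.ScenarioCensusSubgridMeter
import HarnessLib

/-!
# LINE «subgrid-meter» port, part 2/3: the meter reading (§F), endgames (§G), calibration I — the fine-scale law (§H)

Re-homed for the scenario census (typer seat ns-census-typer-1 g8; cells of ns-idea-2 g15 LINE «subgrid-meter» dceda87d33ef0baf, critic idea-crit-3 g8 verdict 05:34Z,
members OF RECORD since census v1.84; this port makes the decided cells TREE-decided): VERBATIM PORT of `pub/ideators/ns-idea-2/lines/subgrid-meter/line-subgrid-meter.lean`
sha16 dceda87d33ef0baf (743 l., lean check rc 0, 0 sorry), split for the 400-line rule into `ScenarioCensusSubgridMeter` (§A–§E) → `…SubgridMeterLaws` (§F–§H) →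
`…SubgridMeterRows` (§K, §I–§J + census KEYS).  Lean text VERBATIM in namespace `…Theorems.ScenarioCensus.SubgridMeter` (the line's `…Lines.SubgridMeter` re-homed);
port edits: `local notation "E3"` → `abbrev E3` (typer lint: no notation in port files), `@[conjecture]` on the OPEN rows `Row_A2kP` / `Row_A2kU` (typed only), one-line
docstrings added where missing (gate lint); the coordinate bound `norm_apply_le_norm` (`‖v i‖ ≤ ‖v‖`, twin of landed tree lemmas) is not re-declared — its uses are
Mathlib's `PiLp.norm_apply_le` (proof text only).  Statements untouched.

No census VALUE is moved here (the cells become TREE-decided by name; booking is the lead's); NS regularity is NOT proved; (L′) ⟨10661⟩ is untouched; no summit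
statement is proved by this file. Lemmas that restate already-landed tree declarations are taken BY NAME (gate lint `dedup.landed`): `norm_apply_le_norm` = `PiLp.norm_apply_le`.
-/

-- the summit and its single problem share the name `NavierStokesRegularity` (D-0017 nested layout)
set_option linter.dupNamespace false

noncomputable section

open Set Function Filter Topology Metric MeasureTheory
open scoped RealInnerProductSpace ENNReal NNReal

namespace Summit.NavierStokesRegularity.NavierStokesRegularity.Theorems.ScenarioCensus.SubgridMeter

open Literature.Analysis Literature.Analysis.FluidPDE Literature.Analysis.UnboundedOperators
open Summit.NavierStokesRegularity.NavierStokesRegularity.Theorems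
open Summit.NavierStokesRegularity.NavierStokesRegularity.Theorems.BlobRiccatiClosure.TypeIApexLiouville
  (stub_typeIGaugeBounds)
open Summit.NavierStokesRegularity.NavierStokesRegularity.Theorems.SymmetryModuliCountSymmetricLiouville
  (vanishes_of_vanishes_before)

/-! ## F. The meter reading: small subgrid energy at a small relative scale ⇒ small strain -/

/-- **METER READING (pointwise law).** For every `C` there is `θ₀ = θ₀(C) > 0` (explicitly
`1/(576 (K₂(C)+1)²)`, `K₂` the KNSS gauge bound on `(−t)^{3/2}‖D²u‖`) such that for `u ∈ A_C`,
`0 < θ ≤ θ₀`, `t < 0` and `x`: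
`(−t) · sgVar (u t) (θ(−t)) x ≤ θ/72 ⇒ (−t)‖∇u(t,x)‖_op ≤ 1/2`. -/
theorem strain_le_half_of_sgVar (C : ℝ) : ∃ θ₀ : ℝ, 0 < θ₀ ∧ ∀ u : ℝ → E3 → E3,
    IsTypeIAncientMild C u → ∀ θ : ℝ, 0 < θ → θ ≤ θ₀ → ∀ t < 0, ∀ x : E3,
      (-t) * sgVar (u t) (θ * (-t)) x ≤ θ / 72 → (-t) * ‖fderiv ℝ (u t) x‖ ≤ 1 / 2 := by
  obtain ⟨K₁, K₂, hK₁, hK₂, hKB⟩ := stub_typeIGaugeBounds C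
  have hK : (0 : ℝ) < K₂ + 1 := by linarith
  refine ⟨1 / (576 * (K₂ + 1) ^ 2), by positivity, fun u hu θ hθ hθ₀ t ht x hvar => ?_⟩
  have hmt : 0 < -t := by linarith
  have hne : (-t) ≠ 0 := hmt.ne'
  set s : ℝ := θ * (-t) with hs_def
  have hs : 0 < s := mul_pos hθ hmt
  -- slice data
  have hcont : Continuous (u t) := hu.continuous_slice ht
  have hM : ∀ z, ‖u t z‖ ≤ C / Real.sqrt (-t) := fun z => hu.norm_le ht z
  have hC2 : ContDiff ℝ 2 (u t) := (hu.contDiff_slice ht).of_le (by norm_cast)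
  have hD1 : ∀ z, ‖fderiv ℝ (u t) z‖ ≤ K₁ / (-t) := fun z => by
    rw [le_div_iff₀ hmt, mul_comm]; exact (hKB u hu t ht z).1
  have hD2 : ∀ z, ‖fderiv ℝ (fderiv ℝ (u t)) z‖ ≤ K₂ / ((-t) * Real.sqrt (-t)) := fun z => by
    have h := (hKB u hu t ht z).2
    rw [← norm_iteratedFDeriv_fderiv, ← norm_iteratedFDeriv_fderiv, norm_iteratedFDeriv_zero] at h
    rw [le_div_iff₀ (mul_pos hmt (Real.sqrt_pos.2 hmt)), mul_comm]; exact h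
  have hcb : ∀ (i : Fin 3) z, ‖u t z i‖ ≤ C / Real.sqrt (-t) := fun i z =>
    (PiLp.norm_apply_le (u t z) i).trans (hM z)
  have hcc : ∀ i : Fin 3, Continuous fun z => u t z i := fun i => continuous_apply_comp hcont i
  set H : E3 → E3 := heatExtension (u t) s with hH_def
  -- Step 1: each component functional of the resolved strain is `≤ 1/(12(−t))`
  have hproj : ∀ i : Fin 3, ‖(prj i).comp (fderiv ℝ H x)‖ ≤ 1 / (12 * (-t)) := fun i => by
    have hRP := two_mul_sq_norm_fderiv_le_cVar (hcc i) (hcb i) hs x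
    have hle : cVar (fun z => u t z i) s x ≤ sgVar (u t) s x :=
      Finset.single_le_sum (f := fun j => cVar (fun z => u t z j) s x)
        (fun j _ => cVar_nonneg (hcc j) (hcb j) hs x) (Finset.mem_univ i)
    have hsg : sgVar (u t) s x ≤ θ / 72 / (-t) := by
      rw [le_div_iff₀ hmt, mul_comm]; exact hvar
    rw [hH_def, ← fderiv_heatExtension_comp hcont hM hs i x]
    set a : ℝ := ‖fderiv ℝ (heatExtension (fun z => u t z i) s) x‖ with ha_def
    have ha : 0 ≤ a := norm_nonneg _
    have h2 : 2 * s * a ^ 2 ≤ θ / 72 / (-t) := (hRP.trans hle).trans hsg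
    have h3 : a ^ 2 ≤ (1 / (12 * (-t))) ^ 2 := by
      have h4 : a ^ 2 ≤ θ / 72 / (-t) / (2 * s) := by
        rw [le_div_iff₀ (by positivity)]; linarith
      calc a ^ 2 ≤ θ / 72 / (-t) / (2 * s) := h4
        _ = (1 / (12 * (-t))) ^ 2 := by rw [hs_def]; field_simp; ring
    calc a = Real.sqrt (a ^ 2) := (Real.sqrt_sq ha).symm
      _ ≤ Real.sqrt ((1 / (12 * (-t))) ^ 2) := Real.sqrt_le_sqrt h3
      _ = 1 / (12 * (-t)) := Real.sqrt_sq (by positivity)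
  -- Step 3: the resolved strain
  have hres : ‖fderiv ℝ H x‖ ≤ 1 / (4 * (-t)) := by
    calc ‖fderiv ℝ H x‖ ≤ ∑ i, ‖(prj i).comp (fderiv ℝ H x)‖ := opNorm_le_sum_proj _
      _ ≤ ∑ _i : Fin 3, 1 / (12 * (-t)) := Finset.sum_le_sum fun i _ => hproj i
      _ = 1 / (4 * (-t)) := by
          simp only [Finset.sum_const, Finset.card_univ, Fintype.card_fin, nsmul_eq_mul]
          push_cast; field_simp; ring
  -- Step 2: the subgrid strain
  have hsub : ‖fderiv ℝ (u t) x - fderiv ℝ H x‖ ≤ 1 / (4 * (-t)) := by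
    have h := norm_fderiv_sub_fderiv_heatExtension_le hC2 hM hD1 hD2 hs x
    have hsqs : Real.sqrt s = Real.sqrt θ * Real.sqrt (-t) := by
      rw [hs_def]; exact Real.sqrt_mul hθ.le _
    have hθs : Real.sqrt θ ≤ 1 / (24 * (K₂ + 1)) := by
      calc Real.sqrt θ ≤ Real.sqrt (1 / (576 * (K₂ + 1) ^ 2)) := Real.sqrt_le_sqrt hθ₀
        _ = 1 / (24 * (K₂ + 1)) := by
          rw [show (1 : ℝ) / (576 * (K₂ + 1) ^ 2) = (1 / (24 * (K₂ + 1))) ^ 2 by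
            field_simp; ring]
          exact Real.sqrt_sq (by positivity)
    have hsrt : 0 < Real.sqrt (-t) := Real.sqrt_pos.2 hmt
    have hfrac : K₂ / (K₂ + 1) ≤ 1 := by rw [div_le_one hK]; linarith
    calc ‖fderiv ℝ (u t) x - fderiv ℝ H x‖
        ≤ K₂ / ((-t) * Real.sqrt (-t)) * (6 * Real.sqrt s) := h
      _ = 6 * K₂ * Real.sqrt θ / (-t) := by rw [hsqs]; field_simp
      _ ≤ 6 * K₂ * (1 / (24 * (K₂ + 1))) / (-t) := by
          apply div_le_div_of_nonneg_right _ hmt.le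
          exact mul_le_mul_of_nonneg_left hθs (by positivity)
      _ = (1 / 4) * (K₂ / (K₂ + 1)) / (-t) := by field_simp; ring
      _ ≤ (1 / 4) * 1 / (-t) := by
          apply div_le_div_of_nonneg_right _ hmt.le
          exact mul_le_mul_of_nonneg_left hfrac (by norm_num)
      _ = 1 / (4 * (-t)) := by field_simp
  -- combine
  have htri : ‖fderiv ℝ (u t) x‖ ≤ ‖fderiv ℝ (u t) x - fderiv ℝ H x‖ + ‖fderiv ℝ H x‖ := by
    have := norm_add_le (fderiv ℝ (u t) x - fderiv ℝ H x) (fderiv ℝ H x)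
    rwa [sub_add_cancel] at this
  have hfin : ‖fderiv ℝ (u t) x‖ ≤ 1 / (2 * (-t)) := by
    calc ‖fderiv ℝ (u t) x‖ ≤ 1 / (4 * (-t)) + 1 / (4 * (-t)) := htri.trans (add_le_add hsub hres)
      _ = 1 / (2 * (-t)) := by field_simp; ring
  rw [le_div_iff₀ (by positivity : (0 : ℝ) < 2 * (-t))] at hfin
  linarith

/-! ## G. Endgames (tree theorems only) -/

/-- **Census A2g (tree).** `(−t)‖∇u(t)‖_op ≤ ½` everywhere forces `u ≡ 0`
(`clockStretchingLaw_smallStrainRung_proof`). -/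
theorem eq_zero_of_strain_le_half {C : ℝ} {u : ℝ → E3 → E3} (hu : IsTypeIAncientMild C u)
    (h : ∀ t < 0, ∀ x, (-t) * ‖fderiv ℝ (u t) x‖ ≤ 1 / 2) : ∀ t < 0, ∀ x, u t x = 0 := by
  have hstrain : ∀ t < 0, ∀ x, ‖fderiv ℝ (u t) x‖ ≤ (1 / 2) / (-t) := fun t ht x => by
    rw [le_div_iff₀ (by linarith : (0 : ℝ) < -t), mul_comm]; exact h t ht x
  intro t ht x
  exact clockStretchingLaw_smallStrainRung_proof C u (isTypeIAncientMild_iff.1 hu) hstrain t ht x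

/-- **Backward-end form.** Smallness of the strain only for `t < T` (`T ≤ 0`) suffices: shift the
element back in time (`IsTypeIAncientMild.comp_sub_right`; the weight `−t` only grows), apply A2g,
and carry the vanishing up to `t < 0` by forward uniqueness (`vanishes_of_vanishes_before`). -/
theorem eq_zero_of_strain_le_half_before {C : ℝ} {u : ℝ → E3 → E3} (hu : IsTypeIAncientMild C u)
    {T : ℝ} (hT : T ≤ 0) (h : ∀ t < T, ∀ x, (-t) * ‖fderiv ℝ (u t) x‖ ≤ 1 / 2) :
    ∀ t < 0, ∀ x, u t x = 0 := by
  set δ : ℝ := 1 - T with hδ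
  have hδ0 : 0 ≤ δ := by rw [hδ]; linarith
  have hv : IsTypeIAncientMild C (fun t => u (t - δ)) := hu.comp_sub_right hδ0
  have hvz : ∀ t < 0, ∀ x, (fun t => u (t - δ)) t x = 0 := by
    refine eq_zero_of_strain_le_half hv (fun t ht x => ?_)
    have hτ : t - δ < T := by rw [hδ]; linarith
    have key := h _ hτ x
    have hmono : (-t) * ‖fderiv ℝ (u (t - δ)) x‖ ≤ (-(t - δ)) * ‖fderiv ℝ (u (t - δ)) x‖ :=
      mul_le_mul_of_nonneg_right (by linarith) (norm_nonneg _)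
    exact hmono.trans key
  refine vanishes_of_vanishes_before hu (by linarith : T - 1 < 0) (fun t ht x => ?_)
  have := hvz (t + δ) (by rw [hδ]; linarith) x
  simpa using this

/-! ## H. Calibration I — the fine-scale law (local Poincaré) -/

/-- `Var_s[f](x) ≤ 2s·‖∇f‖_∞²` (the tree's local Poincaré inequality
`sq_integral_heatKernel_poincare`, applied to `z ↦ f(x − z)`). -/
theorem cVar_le_of_fderiv_le {f : E3 → ℝ} (hf : ContDiff ℝ 1 f) {C₀ C₁ : ℝ}
    (h0 : ∀ z, ‖f z‖ ≤ C₀) (h1 : ∀ z, ‖fderiv ℝ f z‖ ≤ C₁) {s : ℝ} (hs : 0 < s) (x : E3) :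
    cVar f s x ≤ 2 * s * C₁ ^ 2 := by
  have hC₁ : 0 ≤ C₁ := (norm_nonneg _).trans (h1 0)
  set g : E3 → ℝ := fun z => f (x - z) with hg
  have hlin1 : ContDiff ℝ 1 (fun z : E3 => x - z) := (contDiff_const (c := x)).sub contDiff_id
  have hgd : ContDiff ℝ 1 g := hf.comp hlin1
  have hg0 : ∀ z, ‖g z‖ ≤ C₀ := fun z => h0 _
  have hg1 : ∀ z, ‖fderiv ℝ g z‖ ≤ C₁ := fun z => by
    have hlin : HasFDerivAt (fun z : E3 => x - z) (-(ContinuousLinearMap.id ℝ E3)) z :=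
      (hasFDerivAt_id (𝕜 := ℝ) z).const_sub x
    have hder : HasFDerivAt g ((fderiv ℝ f (x - z)).comp (-(ContinuousLinearMap.id ℝ E3))) z :=
      ((hf.differentiable one_ne_zero) (x - z)).hasFDerivAt.comp z hlin
    rw [hder.fderiv]
    calc ‖(fderiv ℝ f (x - z)).comp (-(ContinuousLinearMap.id ℝ E3))‖
        ≤ ‖fderiv ℝ f (x - z)‖ * ‖-(ContinuousLinearMap.id ℝ E3)‖ :=
          ContinuousLinearMap.opNorm_comp_le _ _
      _ ≤ C₁ * 1 := by
          refine mul_le_mul (h1 _) ?_ (norm_nonneg _) hC₁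
          rw [norm_neg]; exact ContinuousLinearMap.norm_id_le
      _ = C₁ := mul_one _
  have hP := sq_integral_heatKernel_poincare hs hgd hg0 hg1
  have hE2 : heatExtension (fun y => f y ^ 2) s x = ∫ z, g z ^ 2 * heatKernel s z := by
    rw [heatExtension_apply]
    refine integral_congr_ae (Eventually.of_forall fun z => ?_)
    simp only [hg, smul_eq_mul]; ring
  have hE1 : heatExtension f s x = ∫ z, g z * heatKernel s z := by
    rw [heatExtension_apply]
    refine integral_congr_ae (Eventually.of_forall fun z => ?_)
    simp only [hg, smul_eq_mul]; ring
  have hD : ∫ z, ‖fderiv ℝ g z‖ ^ 2 * heatKernel s z ≤ C₁ ^ 2 := by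
    calc ∫ z, ‖fderiv ℝ g z‖ ^ 2 * heatKernel s z ≤ ∫ z : E3, C₁ ^ 2 * heatKernel s z := by
          refine integral_mono_of_nonneg (Eventually.of_forall fun z =>
              mul_nonneg (sq_nonneg _) (heatKernel_pos hs z).le)
            ((integrable_heatKernel_holds hs).const_mul _) (Eventually.of_forall fun z => ?_)
          exact mul_le_mul_of_nonneg_right (pow_le_pow_left₀ (norm_nonneg _) (hg1 z) 2)
            (heatKernel_pos hs z).le
      _ = C₁ ^ 2 := by rw [integral_const_mul, integral_heatKernel_eq_one_holds hs, mul_one]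
  unfold cVar
  rw [hE2, hE1]
  calc (∫ z, g z ^ 2 * heatKernel s z) - (∫ z, g z * heatKernel s z) ^ 2
      ≤ 2 * s * ∫ z, ‖fderiv ℝ g z‖ ^ 2 * heatKernel s z := hP
    _ ≤ 2 * s * C₁ ^ 2 := mul_le_mul_of_nonneg_left hD (by positivity)

/-- **FINE-SCALE LAW.** `(−t)² · sgVar (u t) s x ≤ 6 K₁(C)² · s` for every `u ∈ A_C`, `t < 0`,
`s > 0`, `x` (`K₁` the KNSS gauge bound on `(−t)‖∇u‖`). -/
theorem fine_law (C : ℝ) : ∃ F : ℝ, 0 ≤ F ∧ ∀ u : ℝ → E3 → E3, IsTypeIAncientMild C u →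
    ∀ t < 0, ∀ s : ℝ, 0 < s → ∀ x : E3, (-t) ^ 2 * sgVar (u t) s x ≤ F * s := by
  obtain ⟨K₁, K₂, hK₁, hK₂, hKB⟩ := stub_typeIGaugeBounds C
  refine ⟨6 * K₁ ^ 2, by positivity, fun u hu t ht s hs x => ?_⟩
  have hmt : 0 < -t := by linarith
  have hne : (-t) ≠ 0 := hmt.ne'
  have hne' : t ≠ 0 := ht.ne
  have hC1 : ContDiff ℝ 1 (u t) := (hu.contDiff_slice ht).of_le (by norm_cast)
  have hM : ∀ z, ‖u t z‖ ≤ C / Real.sqrt (-t) := fun z => hu.norm_le ht z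
  have hD1 : ∀ z, ‖fderiv ℝ (u t) z‖ ≤ K₁ / (-t) := fun z => by
    rw [le_div_iff₀ hmt, mul_comm]; exact (hKB u hu t ht z).1
  have hcomp : ∀ i : Fin 3, cVar (fun z => u t z i) s x ≤ 2 * s * (K₁ / (-t)) ^ 2 := fun i => by
    have hfun : (fun z => u t z i) = fun z => prj i (u t z) := by funext z; rw [prj_apply]
    have hci : ContDiff ℝ 1 (fun z => u t z i) := by rw [hfun]; exact (prj i).contDiff.comp hC1
    have h0i : ∀ z, ‖u t z i‖ ≤ C / Real.sqrt (-t) := fun z =>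
      (PiLp.norm_apply_le (u t z) i).trans (hM z)
    have h1i : ∀ z, ‖fderiv ℝ (fun z => u t z i) z‖ ≤ K₁ / (-t) := fun z => by
      have hdz : HasFDerivAt (fun z => prj i (u t z)) ((prj i).comp (fderiv ℝ (u t) z)) z :=
        (prj i).hasFDerivAt.comp z ((hC1.differentiable one_ne_zero) z).hasFDerivAt
      rw [hfun, hdz.fderiv]
      calc ‖(prj i).comp (fderiv ℝ (u t) z)‖ ≤ ‖prj i‖ * ‖fderiv ℝ (u t) z‖ :=
            ContinuousLinearMap.opNorm_comp_le _ _
        _ ≤ 1 * (K₁ / (-t)) :=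
            mul_le_mul (norm_prj_le i) (hD1 z) (norm_nonneg _) zero_le_one
        _ = K₁ / (-t) := one_mul _
    exact cVar_le_of_fderiv_le hci h0i h1i hs x
  have hsum : sgVar (u t) s x ≤ 3 * (2 * s * (K₁ / (-t)) ^ 2) := by
    calc sgVar (u t) s x = ∑ i : Fin 3, cVar (fun z => u t z i) s x := rfl
      _ ≤ ∑ _i : Fin 3, 2 * s * (K₁ / (-t)) ^ 2 := Finset.sum_le_sum fun i _ => hcomp i
      _ = 3 * (2 * s * (K₁ / (-t)) ^ 2) := by
          simp only [Finset.sum_const, Finset.card_univ, Fintype.card_fin, nsmul_eq_mul]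
          push_cast; ring
  calc (-t) ^ 2 * sgVar (u t) s x ≤ (-t) ^ 2 * (3 * (2 * s * (K₁ / (-t)) ^ 2)) :=
        mul_le_mul_of_nonneg_left hsum (sq_nonneg _)
    _ = 6 * K₁ ^ 2 * s := by field_simp; ring

end Summit.NavierStokesRegularity.NavierStokesRegularity.Theorems.ScenarioCensus.SubgridMeter

end
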